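import Literature.MathematicalPhysics.QuantumFieldTheory.Balaban1983to89.B9GradViaDivLettersAtPinsHolderPairs
import Literature.MathematicalPhysics.QuantumFieldTheory.Balaban1983to89.B9SectDSup

/-!
# `Balaban1983to89.B9CoReadingCoordsInputJump` — the CLASS-BOUNDARY JUMP of n06-d's sharp-cut input norms `bHS` ∕ `bHK`: a lower bound of the
# local size of ANY vector, and what it costs a PRODUCER `HasMaj b₁ (bHS …) T K` ∕ `HasMaj b₁ (weightNorm (bHS …) W) T K` (bond twins alike)

T. Bałaban, *Propagators for lattice gauge theories in a background field*, Commun. Math. Phys. **99** (1985) 389–434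
[`Balaban1985BackgroundPropagators`, "B9"]; [4] = T. Bałaban, *Propagators and renormalization transformations for lattice gauge
theories. II*, Commun. Math. Phys. **96** (1984) 223–250 [`Balaban1984PropagatorsII`].

statement-level skeleton of published theorems with citation tags; proofs where landed; nothing here is a claim about the
Yang–Mills mass gap

THE PRINTED LOCI.  [B9] (3.39)–(3.41) p. 397 (the norms `|λ|`, `‖λ‖_ε`; *"It is understood that the η-scale is used … another scale … indicated
explicitly by a superscript, e.g. ‖·‖^ξ"*), (3.43)–(3.45) p. 398 (*"for ζ ∈ C₀^∞(Δ̃(y))"*, *"supp λ ⊂ Δ(y′)"* — print localises OUTPUTS with SMOOTH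
cut-offs `ζ` and INPUTS by support); [4] (2.51)–(2.52) p. 232 (block majorants), (2.137) p. 247 (the pair parameter `t`).

WHY THIS FILE (cell `pub-ymgap`, node N06, width seat `pub-ymgap-dag-n06-w6` g2; the kernel-checked half of the seat's located note «SHARP-CUT JUMPS»,
HOME `pub-ymgap-dag-n06-w6/BH13-PIN-MEMO.md`).  n06-d's input block norms `B9CoReadingCoordsInputS.bHS sI ε` (site carrier, η-scale pair weight
`wS ε z w = ((|w − z|_T·η)^ε)⁻¹`) and `B9CoReadingCoordsInput.bHK bI ε` (bond carrier, ξ-scale weight `t(z,z′)^{−ε}`) read the SHARP restriction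
`restrS y F` ∕ `restrK y F` of a vector to the class of `y`: designed for SOURCES that vanish off their class (then `loc y` is print's norm of the
zero-extended `λ` and `loc_cut_le` holds with `κ = 1`).  As the TARGET of a majorant the same size counts, for a NON-localised output `T μ`, the
jump `|T μ (z)|` at every pair `(z, w)` with `z` in the class and `w` outside, at the pair weight:
* §1 ★ `holS_ge_jump` ∕ `loc_bHS_ge_jump` (site) and `holK_ge_jump` ∕ `loc_bHK_ge_jump` (bond): for ANY `F`, `wS ε z w · |F (z,s)| ≤ (bHS sI ε).loc y F`
  (resp. `t(z,z′)^{−ε} · |F (z,c)| ≤ (bHK bI ε).loc y F` at an admissible pair) — n06-l's `wS_mul_abs_le_holS_of_off` is the localized-source case;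
* §2 ★★ `jump_le_of_hasMaj_bHS` ∕ `jump_le_of_hasMaj_weightNorm_bHS` (+ `_bHK` twins): ANY producer `HasMaj b₁ (weightNorm (bHS sI ε) W hW) T K` delivers
  `W y · wS ε z w · |T μ (z,s)| ≤ K y y′ · b₁.loc y′ μ` for every `b₁`-localized `μ` and every boundary pair of the class `y` (one line from the definition
  of `B11SectG.HasMaj`);
* §3 the weights at a NEAREST-NEIGHBOUR pair (`supDist s (s.shift ν) = 1`): `wS ε = (L^k)^ε` on charted sites (η-scale: `η = L^{−k}` in the unit where the
  pair distance is `1`), `t^{−ε} = (L^{j(s)})^ε` on bonds (ξ-scale), the shifted bond pair is admissible; ★★★ `jump_le_of_hasMaj_weightNorm_bHS_nbr` ∕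
  `_bHK_nbr`: the producer pays `W y · (L^k)^ε · |T μ (chart s, c)|` (resp. `W y · (L^{j})^ε · |T μ (⟨s,μ⟩, c)|`) at every nearest-neighbour class boundary.
CONSEQUENCE (located, NOT typed here): in the N06 stage-11 certificate (`…N06AtOpsYNuOfRecordV6EPairNP`, binders `bH13` :143, `hL3131H` :161, `hXd` :167)
a PIN `bH13 x := weightNorm (bHS … γ ∣ bHK … γ) W` would make the displayed producer `hL3131H` (`Letters3131H.tbH : HasMaj 𝔠⁽²⁾ (bH13 x) T_b
(t12·(M α₀)·e^{−δT d})`, `T_b` non-local) assert `W y·(L^k)^γ·|T_b μ (z)| ≤ t12·(M α₀)·e^{−δT d(y,y′)}·‖μ‖` at every class boundary of every member —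
for γ > 0 not a member-uniform statement; print avoids the jump with smooth localisers `ζ ∈ C₀^∞(Δ̃(y))` ((3.43)∕(3.45)).  So `bH13` stays a FREE letter and
the D-orbit Hölder members stay displayed until a smooth-partition (or global-form) class family exists.
HONEST SCOPE.  Finite-dimensional bookkeeping about the tree's own definitions; NOTHING of [B9] or [4] is asserted; the certificate is NOT refuted (its
`bH13` is free); COUNT-NEUTRAL; N06 NOT discharged; one finite 𝕋^{d+1} programme at fixed ε — nothing continuum, nothing about the mass gap.
Cell `pub-ymgap` (HUMAN RULING D-0062), Track A node N06 [B9], seat `pub-ymgap-dag-n06-w6` (g2), 2026-08-28.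
-/

noncomputable section

namespace Literature.MathematicalPhysics.QuantumFieldTheory.Balaban1983to89.B9CoReadingCoordsInputJump

open Node00 B6GlobalChartV1 B6KLevelCensusIndexV1
open Node00.OpsYNablaBridge (chartY shift_ne_self)
open B9CoReadingCoords (XBK)
open B9CoReadingCoordsS (XSK)
open B9CoReadingCoordsInput (restrK supK holK bHK supK_nonneg holK_nonneg)
open B9CoReadingCoordsInputS (restrS supS holS bHS supS_nonneg holS_nonneg)
open B9CoReadingCoordsHolderS (wS wS_nonneg)
open B9CoRealizesRelAtLetters (RelB)
open LatticeFieldCalculus (supDist)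
open B9GeoNormsKLevelV1 (geo9K)
open B9Thm34Ext (toB6)
open B9SectDSup (weightNorm)
open B11SectG (HasMaj BlockNorm)
open B9GradViaDivLettersAtPins (supDist_shift_le_one)
open B9GradViaDivLettersAtPinsHolderPairs (wS_chartY tpar_eq)
open B3KernelConvolutionTorus (one_le_supDist_of_ne)

variable {d ℓ : ℕ} {hd : 1 ≤ d + 1} {hL : Odd (ℓ + 1) ∧ 1 < ℓ + 1} {b₀ b₁ : ℝ}
variable (i : KIdx d ℓ hd hL b₀ b₁)
variable {κ : Type} [Fintype κ] [DecidableEq κ]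

/-! ## §1 The jump of the sharp restriction is counted by the local size — for ANY vector -/

section Site

variable [DecidableRel (RelB i)] (sI : SiteY i → IBondY i)

omit [DecidableEq κ] in
/-- ★ **THE CLASS-BOUNDARY JUMP IS BELOW `holS`, FOR ANY VECTOR**: if `z` lies in the class of `y` (through `sI`) and `w ≠ z` does not, then
`wS ε z w · |F (z,s)| ≤ holS ε y F` (the restriction `restrS y F` reads `F (z,s)` at `z` and `0` at `w`).
[cite: Balaban1985BackgroundPropagators, (3.40)–(3.41) p.397 + (3.44) p.398, bookkeeping] -/
theorem holS_ge_jump (ε : ℝ) {y : IBondY i} {z w : SiteY i} (hz : RelB i (sI z) y) (hne : z ≠ w) (hw : ¬ RelB i (sI w) y)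
    (F : XSK κ i → ℝ) (s : Fin (d + 1) × κ × κ) : wS i ε z w * |F (z, s)| ≤ holS i sI ε y F := by
  unfold holS
  have h := le_ciSup (f := fun q : (SiteY i × SiteY i) × Fin (d + 1) × κ × κ =>
      (if q.1.1 ≠ q.1.2 ∧ RelB i (sI q.1.1) y then wS i ε q.1.1 q.1.2 * |restrS i sI y F (q.1.2, q.2) - restrS i sI y F (q.1.1, q.2)| else 0))
      (Finite.bddAbove_range _) ((z, w), s)
  have h1 : restrS i sI y F (w, s) = 0 := by simp [restrS, hw]
  have h2 : restrS i sI y F (z, s) = F (z, s) := by simp [restrS, hz]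
  simp only [if_pos (And.intro hne hz), h1, h2, zero_sub, abs_neg] at h
  exact h

omit [DecidableEq κ] in
/-- ★ **THE LOCAL SIZE OF THE SITE INPUT NORM COUNTS THE JUMP**: `wS ε z w · |F (z,s)| ≤ (bHS sI ε).loc y F` for ANY `F`, at every pair `z` in the class of
`y`, `w ≠ z` outside. [cite: Balaban1985BackgroundPropagators, (3.39)–(3.41) p.397 + (3.44) p.398, bookkeeping] -/
theorem loc_bHS_ge_jump [Fintype (geo9K i).Site] {R : ℝ} {H : Prop} (ε : ℝ) {y : IBondY i} {z w : SiteY i} (hz : RelB i (sI z) y) (hne : z ≠ w)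
    (hw : ¬ RelB i (sI w) y) (F : XSK κ i → ℝ) (s : Fin (d + 1) × κ × κ) :
    wS i ε z w * |F (z, s)| ≤ (bHS (R := R) (H := H) i sI ε).loc y F := by
  show wS i ε z w * |F (z, s)| ≤ supS i sI y F + holS i sI ε y F
  exact (holS_ge_jump i sI ε hz hne hw F s).trans (le_add_of_nonneg_left (supS_nonneg i sI y F))

end Site

section Bond

variable [DecidableRel (RelB i)] (bI : FBondY i → IBondY i)

omit [DecidableEq κ] in
/-- ★ bond twin: **THE CLASS-BOUNDARY JUMP IS BELOW `holK`, FOR ANY VECTOR** — at an admissible pair `(z, z′)` with `z` in the class of `y` (through `bI`)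
and `z′` outside, `t(z,z′)^{−ε} · |F (z,c)| ≤ holK ε y F`. [cite: Balaban1985BackgroundPropagators, (3.40)–(3.41) p.397 + (3.44) p.398; Balaban1984PropagatorsII, (2.137) p.247, bookkeeping] -/
theorem holK_ge_jump (ε : ℝ) {y : IBondY i} {z z' : FBondY i} (hadm : Adm i z z') (hz : RelB i (bI z) y) (hz' : ¬ RelB i (bI z') y)
    (F : XBK κ i → ℝ) (c : Fin (d + 1) × κ × κ) : tpar i z z' ^ (-ε) * |F (z, c)| ≤ holK i bI ε y F := by
  unfold holK
  have h := le_ciSup (f := fun q : (FBondY i × FBondY i) × Fin (d + 1) × κ × κ =>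
      (if Adm i q.1.1 q.1.2 ∧ RelB i (bI q.1.1) y then
        tpar i q.1.1 q.1.2 ^ (-ε) * |restrK i bI y F (q.1.1, q.2) - restrK i bI y F (q.1.2, q.2)| else 0))
      (Finite.bddAbove_range _) ((z, z'), c)
  have h1 : restrK i bI y F (z', c) = 0 := by simp [restrK, hz']
  have h2 : restrK i bI y F (z, c) = F (z, c) := by simp [restrK, hz]
  simp only [if_pos (And.intro hadm hz), h1, h2, sub_zero] at h
  exact h

omit [DecidableEq κ] in
/-- ★ bond twin: **THE LOCAL SIZE OF THE BOND INPUT NORM COUNTS THE JUMP** — `t(z,z′)^{−ε} · |F (z,c)| ≤ (bHK bI ε).loc y F` for ANY `F`.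
[cite: Balaban1985BackgroundPropagators, (3.39)–(3.41) p.397 + (3.44) p.398; Balaban1984PropagatorsII, (2.137) p.247, bookkeeping] -/
theorem loc_bHK_ge_jump [Fintype (geo9K i).Site] {R : ℝ} {H : Prop} (ε : ℝ) {y : IBondY i} {z z' : FBondY i} (hadm : Adm i z z')
    (hz : RelB i (bI z) y) (hz' : ¬ RelB i (bI z') y) (F : XBK κ i → ℝ) (c : Fin (d + 1) × κ × κ) :
    tpar i z z' ^ (-ε) * |F (z, c)| ≤ (bHK (R := R) (H := H) i bI ε).loc y F := by
  show tpar i z z' ^ (-ε) * |F (z, c)| ≤ supK i bI y F + holK i bI ε y F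
  exact (holK_ge_jump i bI ε hadm hz hz' F c).trans (le_add_of_nonneg_left (supK_nonneg i bI y F))

end Bond

/-! ## §2 What a PRODUCER into a sharp-cut class must deliver at every class boundary -/

section Producer

variable [Fintype (geo9K i).Site] [DecidableRel (RelB i)] {R : ℝ} {H : Prop}
variable {F₁ : Type} [AddCommGroup F₁] [Module ℝ F₁]

omit [DecidableEq κ] in
/-- ★★ **A PRODUCER INTO THE SITE INPUT CLASS PAYS EVERY BOUNDARY JUMP OF ITS OUTPUT**: `HasMaj b₁ (bHS sI ε) T K` forces, for every `b₁`-localized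
`μ` (class `y′`) and every pair `z` in the class of `y`, `w ≠ z` outside, `wS ε z w · |T μ (z,s)| ≤ K y y′ · b₁.loc y′ μ`.
[cite: Balaban1984PropagatorsII, (2.51)–(2.52) p.232; Balaban1985BackgroundPropagators, (3.44) p.398, bookkeeping] -/
theorem jump_le_of_hasMaj_bHS (sI : SiteY i → IBondY i) {b₁ : BlockNorm (toB6 (geo9K i) R H) F₁} {T : F₁ →ₗ[ℝ] (XSK κ i → ℝ)}
    {K : IBondY i → IBondY i → ℝ} {ε : ℝ} (h : HasMaj b₁ (bHS i sI ε) T K) {y' : IBondY i} {μ : F₁} (hμ : b₁.IsLoc y' μ)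
    {y : IBondY i} {z w : SiteY i} (hz : RelB i (sI z) y) (hne : z ≠ w) (hw : ¬ RelB i (sI w) y) (s : Fin (d + 1) × κ × κ) :
    wS i ε z w * |T μ (z, s)| ≤ K y y' * b₁.loc y' μ :=
  (loc_bHS_ge_jump i sI ε hz hne hw (T μ) s).trans (h y' μ hμ y)

omit [DecidableEq κ] in
/-- ★★ the same for a RESCALED site input class (the shape of a pin `bH13 := weightNorm (bHS …) W`): `HasMaj b₁ (weightNorm (bHS sI ε) W hW) T K` forces
`W y · (wS ε z w · |T μ (z,s)|) ≤ K y y′ · b₁.loc y′ μ` at every boundary pair.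
[cite: Balaban1984PropagatorsII, (2.51)–(2.52) p.232; Balaban1985BackgroundPropagators, (3.44) p.398 + p.398 (remark after (3.47)), bookkeeping] -/
theorem jump_le_of_hasMaj_weightNorm_bHS (sI : SiteY i → IBondY i) {b₁ : BlockNorm (toB6 (geo9K i) R H) F₁} {T : F₁ →ₗ[ℝ] (XSK κ i → ℝ)}
    {K : IBondY i → IBondY i → ℝ} {ε : ℝ} {W : IBondY i → ℝ} {hW : ∀ y, 0 ≤ W y} (h : HasMaj b₁ (weightNorm (bHS i sI ε) W hW) T K)
    {y' : IBondY i} {μ : F₁} (hμ : b₁.IsLoc y' μ) {y : IBondY i} {z w : SiteY i} (hz : RelB i (sI z) y) (hne : z ≠ w) (hw : ¬ RelB i (sI w) y)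
    (s : Fin (d + 1) × κ × κ) : W y * (wS i ε z w * |T μ (z, s)|) ≤ K y y' * b₁.loc y' μ :=
  (mul_le_mul_of_nonneg_left (loc_bHS_ge_jump i sI ε hz hne hw (T μ) s) (hW y)).trans (h y' μ hμ y)

omit [DecidableEq κ] in
/-- ★★ bond twin: **A PRODUCER INTO THE BOND INPUT CLASS PAYS EVERY BOUNDARY JUMP** — `HasMaj b₁ (bHK bI ε) T K` forces
`t(z,z′)^{−ε} · |T μ (z,c)| ≤ K y y′ · b₁.loc y′ μ` at every admissible boundary pair of the class `y`.
[cite: Balaban1984PropagatorsII, (2.51)–(2.52) p.232 + (2.137) p.247; Balaban1985BackgroundPropagators, (3.44) p.398, bookkeeping] -/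
theorem jump_le_of_hasMaj_bHK (bI : FBondY i → IBondY i) {b₁ : BlockNorm (toB6 (geo9K i) R H) F₁} {T : F₁ →ₗ[ℝ] (XBK κ i → ℝ)}
    {K : IBondY i → IBondY i → ℝ} {ε : ℝ} (h : HasMaj b₁ (bHK i bI ε) T K) {y' : IBondY i} {μ : F₁} (hμ : b₁.IsLoc y' μ)
    {y : IBondY i} {z z' : FBondY i} (hadm : Adm i z z') (hz : RelB i (bI z) y) (hz' : ¬ RelB i (bI z') y) (c : Fin (d + 1) × κ × κ) :
    tpar i z z' ^ (-ε) * |T μ (z, c)| ≤ K y y' * b₁.loc y' μ :=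
  (loc_bHK_ge_jump i bI ε hadm hz hz' (T μ) c).trans (h y' μ hμ y)

omit [DecidableEq κ] in
/-- ★★ bond twin, rescaled: `HasMaj b₁ (weightNorm (bHK bI ε) W hW) T K` forces `W y · (t(z,z′)^{−ε} · |T μ (z,c)|) ≤ K y y′ · b₁.loc y′ μ`.
[cite: Balaban1984PropagatorsII, (2.51)–(2.52) p.232 + (2.137) p.247; Balaban1985BackgroundPropagators, p.398 (remark after (3.47)), bookkeeping] -/
theorem jump_le_of_hasMaj_weightNorm_bHK (bI : FBondY i → IBondY i) {b₁ : BlockNorm (toB6 (geo9K i) R H) F₁} {T : F₁ →ₗ[ℝ] (XBK κ i → ℝ)}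
    {K : IBondY i → IBondY i → ℝ} {ε : ℝ} {W : IBondY i → ℝ} {hW : ∀ y, 0 ≤ W y} (h : HasMaj b₁ (weightNorm (bHK i bI ε) W hW) T K)
    {y' : IBondY i} {μ : F₁} (hμ : b₁.IsLoc y' μ) {y : IBondY i} {z z' : FBondY i} (hadm : Adm i z z') (hz : RelB i (bI z) y)
    (hz' : ¬ RelB i (bI z') y) (c : Fin (d + 1) × κ × κ) : W y * (tpar i z z' ^ (-ε) * |T μ (z, c)|) ≤ K y y' * b₁.loc y' μ :=
  (mul_le_mul_of_nonneg_left (loc_bHK_ge_jump i bI ε hadm hz hz' (T μ) c) (hW y)).trans (h y' μ hμ y)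

end Producer

/-! ## §3 The weights at a nearest-neighbour pair: η-scale `(L^k)^ε` on sites, ξ-scale `(L^{j})^ε` on bonds -/

section Scale

/-- a site and its shift are at sup-distance exactly `1` (the torus has ≥ 2 sites per direction). [cite: Balaban1984PropagatorsII, (2.46) p.231, bookkeeping] -/
theorem supDist_shift_eq_one (s : Site (PV d ℓ i.m i.K hd hL) 0) (ν : Fin (d + 1)) : supDist s (s.shift ν) = 1 := by
  refine le_antisymm (supDist_shift_le_one i s ν) ?_
  have h : (1 : ℝ) ≤ (supDist s (s.shift ν) : ℝ) := one_le_supDist_of_ne (shift_ne_self i s ν)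
  exact_mod_cast h

/-- the charted site and its charted shift are distinct. [cite: Balaban1984PropagatorsII, (2.46) p.231, bookkeeping] -/
theorem chartY_shift_ne (s : Site (PV d ℓ i.m i.K hd hL) 0) (ν : Fin (d + 1)) : chartY i s ≠ chartY i (s.shift ν) :=
  fun h => shift_ne_self i s ν ((chartY i).injective h).symm

/-- ★ **η-SCALE**: at a nearest-neighbour pair the site weight is `wS ε (chart s) (chart (s + e_ν)) = (L^k)^ε` (`= η^{−ε}` in the unit where the pair distance
is `1`). [cite: Balaban1985BackgroundPropagators, (3.40) p.397 («the η-scale is used»), dictionary] -/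
theorem wS_chartY_shift (ε : ℝ) (s : Site (PV d ℓ i.m i.K hd hL) 0) (ν : Fin (d + 1)) :
    wS i ε (chartY i s) (chartY i (s.shift ν)) = ((((ℓ + 1 : ℕ) : ℝ)) ^ i.k) ^ ε := by
  rw [wS_chartY, supDist_shift_eq_one i s ν, Nat.cast_one, one_div, Real.inv_rpow (by positivity), inv_inv]

/-- the ξ-scale pair parameter of two bonds with DISTINCT sources is at least `(L^{j(z)})⁻¹` (`|s − s′|_∞ ≥ 1`), so the weight `t^{−ε}` (`ε ≥ 0`) of
any such pair is at most `(L^{j(z)})^ε`, with equality at nearest neighbours (`tpar_shift_rpow_neg`).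
[cite: Balaban1984PropagatorsII, (2.137) p.247, bookkeeping] -/
theorem inv_pow_le_tpar_of_ne {z z' : FBondY i} (hne : z.src ≠ z'.src) :
    ((((ℓ + 1 : ℕ) : ℝ)) ^ (blkV1 i.hN i.D z).1.1)⁻¹ ≤ tpar i z z' := by
  unfold tpar
  rw [inv_eq_one_div]
  exact div_le_div_of_nonneg_right (one_le_supDist_of_ne (Ne.symm hne)) (by positivity)

/-- the shifted same-direction bond pair `(⟨s,μ⟩, ⟨s + e_ν, μ⟩)` is admissible (`|s − s′|_∞ = 1 ≤ L^{j}`). [cite: Balaban1984PropagatorsII, (2.137) p.247, bookkeeping] -/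
theorem adm_shift (s : Site (PV d ℓ i.m i.K hd hL) 0) (μ ν : Fin (d + 1)) : Adm i ⟨s, μ⟩ ⟨s.shift ν, μ⟩ := by
  refine ⟨rfl, ?_, ?_⟩
  · show supDist s (s.shift ν) ≤ _
    rw [supDist_shift_eq_one i s ν]; exact Nat.one_le_pow _ _ (Nat.succ_pos ℓ)
  · show supDist s (s.shift ν) ≤ _
    rw [supDist_shift_eq_one i s ν]; exact Nat.one_le_pow _ _ (Nat.succ_pos ℓ)

/-- ★ **ξ-SCALE**: at the shifted bond pair the pair-parameter weight is `t^{−ε} = (L^{j(s)})^ε`, `j(s)` the level of the class of `⟨s,μ⟩`.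
[cite: Balaban1984PropagatorsII, (2.137) p.247, dictionary] -/
theorem tpar_shift_rpow_neg (ε : ℝ) (s : Site (PV d ℓ i.m i.K hd hL) 0) (μ ν : Fin (d + 1)) :
    tpar i ⟨s, μ⟩ ⟨s.shift ν, μ⟩ ^ (-ε) = ((((ℓ + 1 : ℕ) : ℝ)) ^ (blkV1 i.hN i.D (⟨s, μ⟩ : FBondY i)).1.1) ^ ε := by
  rw [tpar_eq, supDist_shift_eq_one i s ν, Nat.cast_one, one_div, Real.rpow_neg (by positivity), Real.inv_rpow (by positivity), inv_inv]

variable [Fintype (geo9K i).Site] [DecidableRel (RelB i)] {R : ℝ} {H : Prop}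
variable {F₁ : Type} [AddCommGroup F₁] [Module ℝ F₁]

omit [DecidableEq κ] in
/-- ★★★ **THE PRICE OF A SHARP-CUT SITE PIN AT A NEAREST-NEIGHBOUR CLASS BOUNDARY**: a producer `HasMaj b₁ (weightNorm (bHS sI ε) W hW) T K` delivers
`W y · ((L^k)^ε · |T μ (chart s, c)|) ≤ K y y′ · b₁.loc y′ μ` whenever `chart s` lies in the class of `y` and `chart (s + e_ν)` does not — the factor
`(L^k)^ε` is the η-scale jump weight. [cite: Balaban1985BackgroundPropagators, (3.40) p.397 + (3.44) p.398; Balaban1984PropagatorsII, (2.51)–(2.52) p.232, bookkeeping] -/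
theorem jump_le_of_hasMaj_weightNorm_bHS_nbr (sI : SiteY i → IBondY i) {b₁ : BlockNorm (toB6 (geo9K i) R H) F₁} {T : F₁ →ₗ[ℝ] (XSK κ i → ℝ)}
    {K : IBondY i → IBondY i → ℝ} {ε : ℝ} {W : IBondY i → ℝ} {hW : ∀ y, 0 ≤ W y} (h : HasMaj b₁ (weightNorm (bHS i sI ε) W hW) T K)
    {y' : IBondY i} {μ : F₁} (hμ : b₁.IsLoc y' μ) {y : IBondY i} {s : Site (PV d ℓ i.m i.K hd hL) 0} {ν : Fin (d + 1)}
    (hz : RelB i (sI (chartY i s)) y) (hw : ¬ RelB i (sI (chartY i (s.shift ν))) y) (c : Fin (d + 1) × κ × κ) :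
    W y * (((((ℓ + 1 : ℕ) : ℝ)) ^ i.k) ^ ε * |T μ (chartY i s, c)|) ≤ K y y' * b₁.loc y' μ := by
  rw [← wS_chartY_shift i ε s ν]
  exact jump_le_of_hasMaj_weightNorm_bHS i sI h hμ hz (chartY_shift_ne i s ν) hw c

omit [DecidableEq κ] in
/-- ★★★ bond twin: a producer `HasMaj b₁ (weightNorm (bHK bI ε) W hW) T K` delivers `W y · ((L^{j})^ε · |T μ (⟨s,μ⟩, c)|) ≤ K y y′ · b₁.loc y′ μ` whenever
`bI ⟨s,μ⟩` lies in the class of `y` and `bI ⟨s + e_ν, μ⟩` does not — the factor `(L^{j})^ε` is the ξ-scale jump weight at the level `j` of the class.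
[cite: Balaban1984PropagatorsII, (2.137) p.247 + (2.51)–(2.52) p.232; Balaban1985BackgroundPropagators, (3.44) p.398, bookkeeping] -/
theorem jump_le_of_hasMaj_weightNorm_bHK_nbr (bI : FBondY i → IBondY i) {b₁ : BlockNorm (toB6 (geo9K i) R H) F₁} {T : F₁ →ₗ[ℝ] (XBK κ i → ℝ)}
    {K : IBondY i → IBondY i → ℝ} {ε : ℝ} {W : IBondY i → ℝ} {hW : ∀ y, 0 ≤ W y} (h : HasMaj b₁ (weightNorm (bHK i bI ε) W hW) T K)
    {y' : IBondY i} {μ : F₁} (hμ : b₁.IsLoc y' μ) {y : IBondY i} {s : Site (PV d ℓ i.m i.K hd hL) 0} {μ₀ ν : Fin (d + 1)}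
    (hz : RelB i (bI ⟨s, μ₀⟩) y) (hz' : ¬ RelB i (bI ⟨s.shift ν, μ₀⟩) y) (c : Fin (d + 1) × κ × κ) :
    W y * (((((ℓ + 1 : ℕ) : ℝ)) ^ (blkV1 i.hN i.D (⟨s, μ₀⟩ : FBondY i)).1.1) ^ ε * |T μ (⟨s, μ₀⟩, c)|) ≤ K y y' * b₁.loc y' μ := by
  rw [← tpar_shift_rpow_neg i ε s μ₀ ν]
  exact jump_le_of_hasMaj_weightNorm_bHK i bI h hμ (adm_shift i s μ₀ ν) hz hz' c

end Scale

end Literature.MathematicalPhysics.QuantumFieldTheory.Balaban1983to89.B9CoReadingCoordsInputJump
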